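import Summits.SmoothPoincare4.SmoothPoincare4.Theorems.SullivanDualHyperbolicEndTaubesModelIdentities
import Summits.SmoothPoincare4.SmoothPoincare4.Theorems.SullivanDualHyperbolicEndHelperTaubesCoframe

/-!
# Route `SullivanDual`, crux `HyperbolicEnd` (stmt-SmoothPoincare4-7825), line `taubes-circle-pencil`:
# the graph Cauchy–Riemann system of `J♭`

Registered helper `helper_taubesJ_graphSystem`.  In Taubes' untwisted model on `S¹ × B³`
(Geom. Topol. 2 (1998), §1, eqs. (1.4), (1.10)–(1.11)) write `a = taubesR y − 1`, `b = y₂`, `c = y₃`,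
`ρ² = a² + b²`, `ρ²dφ = a db − b da`, `h = H = c ρ²` (so `dH(u) = ρ² u₃ + 2c (a da(u) + b u₂)`),
`f = Q`, `dQ = taubesDQ`, `dt = taubesDt`, `g = |∇Q| = taubesGrad`.  A `J♭`-holomorphic surface that is
transverse to the F1 leaves `{t, Q = const}` is locally a graph `(t, f) ↦ (φ, h)`; with `X₁ = u` the
lift of `∂_t` (`dt(u) = 1`, `dQ(u) = 0`) the lift of `∂_f` is `X₂ = J♭X₁ / |∇Q|` — the first two
conjuncts `dt(X₂) = 0`, `dQ(X₂) = 1` — and the last two conjuncts are the GRAPH CAUCHY–RIEMANN SYSTEM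
`h_f = ρ² φ_t`, `ρ² φ_f = −h_t / |∇Q|²` (i.e. `h_t = −|∇Q|² ρ² φ_f`), on which the local analysis of
second-type ends (vertical sheets `λ± = √(±h) e^{±iφ}` holomorphic in `w = t + iu`) rests.

Proof: immediate from the coframe identities `helper_taubesJ_coframe`
(`dt ∘ J♭ = −dQ/g`, `dQ ∘ J♭ = g dt`, `dH ∘ J♭ = g ρ²dφ`, `ρ²dφ ∘ J♭ = −dH/g`, `g = |∇Q| > 0` by
`helper_taubesGrad_pos`), the homogeneity of the linear forms `dt`, `da`, `dQ`, `dy₂`, `dy₃` in the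
vector argument, and `dt(u) = 1`, `dQ(u) = 0`.
-/

-- the registered namespace `Summit.SmoothPoincare4.SmoothPoincare4.…` repeats a component (P = Sub)
set_option linter.dupNamespace false

noncomputable section

namespace Summit.SmoothPoincare4.SmoothPoincare4.Cruxes.HyperbolicEnd.TaubesCirclePencil

/-- Homogeneity of `dt` in the vector argument: `dt(c • w) = c · dt(w)`. [folklore] -/
theorem taubesDt_smul (y w : EuclideanSpace ℝ (Fin 4)) (c : ℝ) :
    taubesDt y (c • w) = c * taubesDt y w := by
  simp only [taubesDt, PiLp.smul_apply, smul_eq_mul]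
  ring

/-- Homogeneity of `da` in the vector argument: `da(c • w) = c · da(w)`. [folklore] -/
theorem taubesDa_smul (y w : EuclideanSpace ℝ (Fin 4)) (c : ℝ) :
    taubesDa y (c • w) = c * taubesDa y w := by
  simp only [taubesDa, PiLp.smul_apply, smul_eq_mul]
  ring

/-- Homogeneity of `dQ` in the vector argument: `dQ(c • w) = c · dQ(w)`. [folklore] -/
theorem taubesDQ_smul (y w : EuclideanSpace ℝ (Fin 4)) (c : ℝ) :
    taubesDQ y (c • w) = c * taubesDQ y w := by
  simp only [taubesDQ, taubesDa_smul, PiLp.smul_apply, smul_eq_mul]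
  ring

/-- **The graph Cauchy–Riemann system of `J♭`.**  On the punctured tube let `u` be the lift of `∂_t`
to a `J♭`-complex 2-plane transverse to the F1 leaves (`dt(u) = 1`, `dQ(u) = 0`) and put
`X₂ = |∇Q|⁻¹ J♭u`.  Then `dt(X₂) = 0`, `dQ(X₂) = 1` (so `X₂` is the lift of `∂_f`, `f = Q`), and with
`ρ² = (r−1)² + y₂²`, `(ρ²dφ)(w) = (r−1) w₂ − y₂ da(w)`, `dH(w) = ρ² w₃ + 2y₃((r−1) da(w) + y₂ w₂)`
(`H = y₃ ρ²`): `dH(X₂) = (ρ²dφ)(u)` and `(ρ²dφ)(X₂) = −dH(u)/|∇Q|²`, i.e. for the graph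
`(t, f) ↦ (φ, h)` of a `J♭`-holomorphic surface `h_f = ρ² φ_t` and `ρ² φ_f = −h_t/|∇Q|²`.
[cite: Taubes1998S1B3, §1 eqs. (1.4), (1.10)–(1.11)] -/
theorem helper_taubesJ_graphSystem :
    ∀ (δ : ℝ) (y : EuclideanSpace ℝ (Fin 4)), 0 < δ → δ < 1 → y ∈ taubesTube δ → y ∉ taubesCore →
      ∀ u : EuclideanSpace ℝ (Fin 4), taubesDt y u = 1 → taubesDQ y u = 0 →
        taubesDt y ((taubesGrad y)⁻¹ • taubesJ y u) = 0 ∧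
        taubesDQ y ((taubesGrad y)⁻¹ • taubesJ y u) = 1 ∧
        ((taubesR y - 1) ^ 2 + y 2 ^ 2) * ((taubesGrad y)⁻¹ • taubesJ y u) 3 +
            2 * y 3 * ((taubesR y - 1) * taubesDa y ((taubesGrad y)⁻¹ • taubesJ y u) +
              y 2 * ((taubesGrad y)⁻¹ • taubesJ y u) 2) =
          (taubesR y - 1) * u 2 - y 2 * taubesDa y u ∧
        (taubesR y - 1) * ((taubesGrad y)⁻¹ • taubesJ y u) 2 -
            y 2 * taubesDa y ((taubesGrad y)⁻¹ • taubesJ y u) =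
          -(((taubesR y - 1) ^ 2 + y 2 ^ 2) * u 3 +
              2 * y 3 * ((taubesR y - 1) * taubesDa y u + y 2 * u 2)) / taubesGrad y ^ 2 := by
  intro δ y hδ0 hδ1 hy hc u hdt hdQ
  have hg : taubesGrad y ≠ 0 := (helper_taubesGrad_pos δ y hδ0 hδ1 hy hc).ne'
  obtain ⟨h1, h2, h3, h4⟩ := helper_taubesJ_coframe δ y hδ0 hδ1 hy hc u
  refine ⟨?_, ?_, ?_, ?_⟩
  · rw [taubesDt_smul, h1, hdQ]
    simp
  · rw [taubesDQ_smul, h2, hdt]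
    field_simp
  · simp only [taubesDa_smul, PiLp.smul_apply, smul_eq_mul]
    have h3' : (taubesGrad y)⁻¹ * (((taubesR y - 1) ^ 2 + y 2 ^ 2) * (taubesJ y u) 3 +
        2 * y 3 * ((taubesR y - 1) * taubesDa y (taubesJ y u) + y 2 * (taubesJ y u) 2)) =
        (taubesR y - 1) * u 2 - y 2 * taubesDa y u := by
      rw [h3]
      field_simp
    linear_combination h3'
  · simp only [taubesDa_smul, PiLp.smul_apply, smul_eq_mul]
    have h4' : (taubesGrad y)⁻¹ * ((taubesR y - 1) * (taubesJ y u) 2 - y 2 * taubesDa y (taubesJ y u)) =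
        -(((taubesR y - 1) ^ 2 + y 2 ^ 2) * u 3 +
            2 * y 3 * ((taubesR y - 1) * taubesDa y u + y 2 * u 2)) / taubesGrad y ^ 2 := by
      rw [h4]
      field_simp
    linear_combination h4'

end Summit.SmoothPoincare4.SmoothPoincare4.Cruxes.HyperbolicEnd.TaubesCirclePencil

end
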